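import Summits.Ventures.YMGap.RobustBall.StarBoundaryDecayZd
import Summits.Ventures.YMGap.RobustBall.MemberPressure
import Summits.Ventures.YMGap.RobustBall.WilsonOneStateSymmetry
import Summits.Ventures.YMGap.RobustBall.FreeEnergyLaw
import Summits.Ventures.YMGap.Thresholds.PressureDerivative
import HarnessLib

/-!
# Venture YMGap, track ROBUST-BALL — «C-DS-I»: THE FINITE-VOLUME FREE ENERGY WITH AN ARBITRARY BOUNDARY FIELD IS THE VOLUME
# TERM PLUS A BOUNDARY-UNIFORM SURFACE TERM (the Dobrushin–Shlosman complete-analyticity Condition I shape), `SU(2)` on `ℤ⁴`,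
# EVERY `0 ≤ β_W ≤ 9/25`

HONEST FRAMING. WHAT THIS IS: a venture file (cell `pub-ymgap`, track Y2 ROBUST-BALL / DS, seat ds-3, theorems only, 0 compute).
Strong-coupling LATTICE statements about the normaliser `Z_Λ(b|η) = ∫ exp(−b S_Λ(ζ ⊕ η_{Λᶜ})) ∏_{e∈Λ} dζ_e` of the Wilson DLR kernel
`γ_Λ(·|η)` (tree `ymSpecification`, boundary Wilson action `S_Λ = Σ_{p ∩ Λ ≠ ∅} (N − Re tr U_p)` = tree `wilsonBoundaryAction`) of a
FINITE link volume `Λ ⊂ links(ℤ^d)` with an ARBITRARY boundary field `η`: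
* generic (every compact metrisable `G`, continuous `ρ`, every `d`, every coupling): `log Z_Λ(t|η)` is the cumulant generating function
  of `−S_Λ` (`log_normaliser_eq_cgf`), `log Z_Λ(0|η) = 0`, and ★ `hasDerivAt_log_normaliser`:
  `d/dt log Z_Λ(t|η) = −γ_Λ^t(S_Λ|η)` (the finite-volume energy with boundary condition is minus the coupling-derivative of the free energy);
* ★★★ `su2_abs_log_normaliser_sub_freeEnergy_le` — `SU(2)`, `d = 4`, tree coupling `0 ≤ b ≤ 9/50` (Wilson `β_W = 2b ≤ 9/25`, the whole
  vertex-star window): for EVERY finite `Λ`, EVERY boundary field `η`, every depth function `φ` of `Λ` (`φ x ≤ φ y + ‖x.1 − y.1‖_∞`,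
  `φ > 0 ⇒ ∈ Λ`) and depths `m_p ≤ φ` on the links of `p`:
  `|log Z_Λ(b|η) − (#T(Λ)/6) · f(b)| ≤ b · Σ_{p ∈ T(Λ)} min 4 (1024√2 · exp(−κ(2b) ⌊m_p/4⌋))`,
  `T(Λ) = plaquettesTouching Λ`, `f = freeEnergyDensity 4 ρ` the infinite-volume free energy per site (six plaquettes per site),
  `κ(β_W) = starRate 4 (R_G β_W) > 0` the Dobrushin–Shlosman star rate: the free energy of a finite region with ANY frozen boundary links
  equals the volume term up to a term summable over the depth — a SURFACE term — with ONE constant for all volumes and all boundary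
  fields; ★★ `su2_abs_log_normaliser_sub_log_normaliser_le` — two boundary fields change `log Z_Λ` by at most twice that surface term.
MECHANISM: `d/dt (log Z_Λ(t|η) − (#T/6) f(t)) = Σ_{p∈T(Λ)} (γ_Λ^t(W_p|η) − μ_t(W_p))` by `hasDerivAt_log_normaliser`, ds-1's
`su2_hasDerivWithinAt_freeEnergyDensity` (`f' = −Σ_{i<j}(2 − μ_t(W_{ij}))`) and the axis symmetry of the one state
(`su2_wilson_oneState_symmetric` + `PlaquettePositivity.integral_plaquetteObs_eq`); each term is `≤ 4` and, for plaquettes inside `Λ`,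
`≤ 1024√2 e^{−κ(2t)⌊m_p/4⌋}` by the seat's boundary decay on the star window (`su2_wilson_boundary_star`), `κ(2t) ≥ κ(2b)`; the mean
value inequality on `[0, b]` and `log Z_Λ(0|η) = f(0) = 0` finish.
WHAT THIS IS NOT: not Dobrushin–Shlosman's full complete analyticity (no complex couplings, no mixing condition here — those are the
seat's `KernelClustering*` / `StarKernelClustering*` files); constants are door artefacts; nothing about the continuum limit or Clay.
References: R. L. Dobrushin, S. B. Shlosman, *Completely analytical interactions* (1987), Condition I (statement shape only);
S. Friedli, Y. Velenik (2017) §3.2, §4.9 (pressure with boundary conditions); everything here is proved. [folklore]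
-/

noncomputable section

open MeasureTheory ProbabilityTheory Filter Topology Real Finset Set
open scoped NNReal
open Literature.Probability.LatticeModels hiding configShift configShift_apply
open Literature.MathematicalPhysics.QuantumLattice
open Literature.MathematicalPhysics.QuantumFieldTheory (IsLipschitzCylinder isLipschitzCylinder_zdPlaquetteObs zdPlaquetteObs
  haarProbability card_plaquetteEdges_le)
open Summit.Ventures.YMGap.StarWindowGauge (gaugeR gaugeR_lt_one_of_le)
open Summit.Ventures.YMGap.StarLemmaG (gaugeR_nonneg)

namespace Summit.Ventures.YMGap.RobustBall

namespace BoundaryFreeEnergy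

/-! ### Part A — generic: `log Z_Λ(t|η)` is a cumulant generating function; its derivative is minus the kernel energy -/

section Generic

variable {d N : ℕ} {G : Type*} [Group G] [TopologicalSpace G] [IsTopologicalGroup G] [CompactSpace G]
  [MeasurableSpace G] [BorelSpace G] [SecondCountableTopology G] (ρ : G →* Matrix (Fin N) (Fin N) ℂ)

omit [SecondCountableTopology G] in
/-- `log Z_Λ(t|η)` is the cumulant generating function, at `t`, of `ζ ↦ −S_Λ(ζ ⊕ η_{Λᶜ})` under the product Haar law on the links of `Λ`.
[folklore] -/
theorem log_normaliser_eq_cgf (t : ℝ) (Λ : Finset (ZdEdge d)) (η : LGConfig d G) :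
    Real.log (∫ ζ, Real.exp (-t * wilsonBoundaryAction ρ Λ (glueWith Λ ζ η))
        ∂(Measure.pi fun _ : ↥Λ => haarProbability G)) =
      cgf (fun ζ : ↥Λ → G => -wilsonBoundaryAction ρ Λ (glueWith Λ ζ η))
        (Measure.pi fun _ : ↥Λ => haarProbability G) t := by
  simp only [cgf, mgf, neg_mul, mul_neg]

omit [SecondCountableTopology G] in
/-- `log Z_Λ(0|η) = 0` (Haar measure is normalised). [folklore] -/
theorem log_normaliser_zero (Λ : Finset (ZdEdge d)) (η : LGConfig d G) :
    Real.log (∫ ζ, Real.exp (-(0 : ℝ) * wilsonBoundaryAction ρ Λ (glueWith Λ ζ η))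
        ∂(Measure.pi fun _ : ↥Λ => haarProbability G)) = 0 := by
  simp only [neg_zero, zero_mul, Real.exp_zero, integral_const, smul_eq_mul, mul_one, Measure.real, measure_univ,
    ENNReal.toReal_one, Real.log_one]

/-- ★ **The energy with boundary condition is minus the coupling-derivative of the free energy**: for every finite link volume `Λ`,
every boundary field `η` and every real `t`,
`d/dt log Z_Λ(t|η) = −∫ S_Λ dγ_Λ^t(·|η)` (`γ^t` = the Wilson DLR kernel `ymSpecification ρ t`). [folklore] -/
theorem hasDerivAt_log_normaliser (hρ : Continuous ρ) (Λ : Finset (ZdEdge d)) (η : LGConfig d G) (t : ℝ) :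
    HasDerivAt (fun s : ℝ => Real.log (∫ ζ, Real.exp (-s * wilsonBoundaryAction ρ Λ (glueWith Λ ζ η))
        ∂(Measure.pi fun _ : ↥Λ => haarProbability G)))
      (-(∫ U, wilsonBoundaryAction ρ Λ U ∂(ymSpecification ρ t Λ η))) t := by
  set P0 : Measure (↥Λ → G) := Measure.pi fun _ : ↥Λ => haarProbability G with hP0
  set X : (↥Λ → G) → ℝ := fun ζ => -wilsonBoundaryAction ρ Λ (glueWith Λ ζ η) with hX
  have hfun : (fun s : ℝ => Real.log (∫ ζ, Real.exp (-s * wilsonBoundaryAction ρ Λ (glueWith Λ ζ η)) ∂P0)) = cgf X P0 :=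
    funext fun s => log_normaliser_eq_cgf ρ s Λ η
  rw [hfun]
  have hSm : Measurable (wilsonBoundaryAction (G := G) ρ Λ) := (continuous_wilsonBoundaryAction ρ hρ Λ).measurable
  have hXm : Measurable X := (hSm.comp (measurable_glueWith Λ η)).neg
  obtain ⟨C, hC⟩ := exists_bound_of_continuous (continuous_wilsonBoundaryAction ρ hρ Λ)
  have hXb : ∀ ζ, |X ζ| ≤ C := fun ζ => by rw [hX, abs_neg]; exact hC _
  have hint : t ∈ interior (integrableExpSet X P0) := EnergyVariance.mem_interior_integrableExpSet hXm hXb t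
  have hd : HasDerivAt (cgf X P0) (deriv (cgf X P0) t) t := (analyticAt_cgf hint).differentiableAt.hasDerivAt
  convert hd using 1
  rw [← integral_tilted_mul_self hint, integral_tilted_mul_eq_mgf, integral_ymSpecification ρ hρ t Λ hSm η]
  simp only [hX, mgf, smul_eq_mul, mul_neg, neg_mul, ← integral_neg, ← integral_div]
  refine integral_congr_ae (ae_of_all _ fun ζ => ?_)
  ring

end Generic

/-! ### Part B — `SU(2)`, `d = 4`, the vertex-star window `0 ≤ β_W ≤ 9/25` -/

section SU2

/-- The star rate `κ₁(ρ) = (1−ρ)²/(2(16ρ+1))` is antitone in the received sum `ρ ∈ [0, 1]`. [folklore] -/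
theorem starRate_anti {r r' : ℝ} (h0 : 0 ≤ r) (h : r ≤ r') (h1 : r' ≤ 1) : starRate 4 r' ≤ starRate 4 r := by
  unfold starRate
  have hA : 0 < 2 * (2 * r * ((2 * 4 : ℕ) : ℝ) + 1) := by push_cast; nlinarith
  have hA' : 0 < 2 * (2 * r' * ((2 * 4 : ℕ) : ℝ) + 1) := by push_cast; nlinarith
  rw [div_le_div_iff₀ hA' hA]
  push_cast
  have h2 : (1 - r') ^ 2 ≤ (1 - r) ^ 2 := by nlinarith
  have h3 : (0 : ℝ) ≤ (1 - r') ^ 2 := sq_nonneg _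
  nlinarith

/-- `Re tr U_p = 2 · W̄_p` for `SU(2)` (`W̄_p = ½ Re tr U_p` the tree's normalised plaquette `zdPlaquetteObs`). [folklore] -/
theorem plaquetteObs_eq_two_mul_zd (x : Site 4) (i j : Fin 4) (U : LGConfig 4 (SUN 2)) :
    plaquetteObs (fundamentalRep (Fin 2)) x i j U = 2 * zdPlaquetteObs (d := 4) (fundamentalRep (Fin 2)) x i j U := by
  simp only [zdPlaquetteObs, plaquetteObs]
  push_cast
  rw [← mul_assoc, mul_inv_cancel₀ (by norm_num : (2 : ℝ) ≠ 0), one_mul]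
  rfl

/-- **Per-plaquette boundary error on the star window.** `SU(2)`, `d = 4`, tree couplings `0 ≤ t ≤ b ≤ 9/50`, `μ` a DLR state at `t`,
`Λ` a finite volume with boundary field `η` and depth function `φ`, `p` ANY plaquette with `m ≤ φ` on its links:
`|γ_Λ^t(Re tr U_p|η) − μ(Re tr U_p)| ≤ min 4 (1024√2 · exp(−κ(2b)⌊m/4⌋))` (the second bound is the seat's `su2_wilson_boundary_star` for
plaquettes inside `Λ`, with the rate monotone in the coupling; for a plaquette with a link outside `Λ` one has `m ≤ 0`). [folklore] -/
theorem su2_abs_kernel_plaquette_sub_le {t b : ℝ} (ht0 : 0 ≤ t) (htb : t ≤ b) (hb : b ≤ 9 / 50)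
    {μ : Measure (LGConfig 4 (SUN 2))} (hμ : μ ∈ ymGibbsMeasures (d := 4) (fundamentalRep (Fin 2)) t)
    (Λ : Finset (ZdEdge 4)) (η : LGConfig 4 (SUN 2)) (φ : ZdEdge 4 → ℝ)
    (hφ : ∀ x y : ZdEdge 4, φ x ≤ φ y + ‖x.1 - y.1‖) (hφΛ : ∀ x, 0 < φ x → x ∈ Λ)
    (p : ZdPlaquette 4) {m : ℝ} (hm : ∀ x ∈ plaquetteEdges p, m ≤ φ x) :
    |(∫ U, plaquetteObs (fundamentalRep (Fin 2)) p.1 p.2.1.1 p.2.1.2 U ∂(ymSpecification (d := 4) (fundamentalRep (Fin 2)) t Λ η)) -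
        ∫ U, plaquetteObs (fundamentalRep (Fin 2)) p.1 p.2.1.1 p.2.1.2 U ∂μ| ≤
      min 4 (1024 * Real.sqrt 2 * Real.exp (-(starRate 4 (gaugeR (2 * b)) * ⌊m / (4 : ℕ)⌋₊))) := by
  have hρc : Continuous (fundamentalRep (Fin 2)) := continuous_fundamentalRep (Fin 2)
  have hGibbs : IsGibbsMeasure (ymSpecification (d := 4) (fundamentalRep (Fin 2)) t) μ := hμ
  haveI := hGibbs.isProbabilityMeasure
  haveI := isProbabilityMeasure_ymSpecification (fundamentalRep (Fin 2)) hρc t Λ η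
  set W : LGConfig 4 (SUN 2) → ℝ := fun U => plaquetteObs (fundamentalRep (Fin 2)) p.1 p.2.1.1 p.2.1.2 U with hW
  have hWb : ∀ U, |W U| ≤ 2 := fun U => by
    have h := abs_plaquetteObs_le_holds (fundamentalRep (Fin 2)) fundamentalRep_mem_unitaryGroup p.1 p.2.1.1 p.2.1.2 U
    simpa using h
  -- the trivial bound `4`
  have hint : ∀ (ν : Measure (LGConfig 4 (SUN 2))) [IsProbabilityMeasure ν], |∫ U, W U ∂ν| ≤ 2 := fun ν _ => by
    have h := norm_integral_le_of_norm_le_const (μ := ν) (f := W) (C := 2) (ae_of_all _ fun U => by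
      rw [Real.norm_eq_abs]; exact hWb U)
    simpa [Real.norm_eq_abs] using h
  have h4 : |(∫ U, W U ∂(ymSpecification (d := 4) (fundamentalRep (Fin 2)) t Λ η)) - ∫ U, W U ∂μ| ≤ 4 := by
    calc |(∫ U, W U ∂(ymSpecification (d := 4) (fundamentalRep (Fin 2)) t Λ η)) - ∫ U, W U ∂μ|
        ≤ |∫ U, W U ∂(ymSpecification (d := 4) (fundamentalRep (Fin 2)) t Λ η)| + |∫ U, W U ∂μ| := abs_sub _ _
      _ ≤ 2 + 2 := add_le_add (hint _ ) (hint _)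
      _ = 4 := by norm_num
  refine le_min h4 ?_
  -- the rate is monotone in the coupling
  have h2t0 : 0 ≤ 2 * t := by linarith
  have h2t : 2 * t ≤ 9 / 25 := by linarith
  have h2b : 2 * b ≤ 9 / 25 := by linarith
  have hR0 : 0 ≤ gaugeR (2 * t) := gaugeR_nonneg h2t0 (by linarith)
  have hRle : gaugeR (2 * t) ≤ gaugeR (2 * b) := DSWindow.gaugeR_mono h2t0 (by linarith) (by linarith)
  have hR1 : gaugeR (2 * b) ≤ 1 := (gaugeR_lt_one_of_le (by linarith) h2b).le
  have hκ : starRate 4 (gaugeR (2 * b)) ≤ starRate 4 (gaugeR (2 * t)) := starRate_anti hR0 hRle hR1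
  have hexp : Real.exp (-(starRate 4 (gaugeR (2 * t)) * ⌊m / (4 : ℕ)⌋₊)) ≤
      Real.exp (-(starRate 4 (gaugeR (2 * b)) * ⌊m / (4 : ℕ)⌋₊)) := by
    apply Real.exp_le_exp.2
    have : (0 : ℝ) ≤ ⌊m / (4 : ℕ)⌋₊ := Nat.cast_nonneg _
    nlinarith
  by_cases hp : plaquetteEdges p ⊆ Λ
  · -- interior plaquette: the boundary decay on the star window, for `W̄_p = ½ Re tr U_p`
    obtain ⟨x, ⟨⟨i, j⟩, hij⟩⟩ := p
    have hF := isLipschitzCylinder_zdPlaquetteObs (d := 4) (N := 2) x hij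
    have hμ' : μ ∈ ymGibbsMeasures (d := 4) (fundamentalRep (Fin 2)) (2 * t / 2) := by
      rwa [show (2 : ℝ) * t / 2 = t by ring]
    have key := su2_wilson_boundary_star h2t0 h2t hμ' Λ η φ hφ hφΛ hF hp hm
    rw [show (2 : ℝ) * t / 2 = t by ring] at key
    dsimp only at key
    have hcard : ((plaquetteEdges ((x, ⟨(i, j), hij⟩) : ZdPlaquette 4)).card : ℝ) ≤ 4 := by
      exact_mod_cast card_plaquetteEdges_le _
    have hWeq : ∀ U, W U = 2 * zdPlaquetteObs (d := 4) (fundamentalRep (Fin 2)) x i j U := fun U =>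
      plaquetteObs_eq_two_mul_zd x i j U
    have hI1 : (∫ U, W U ∂(ymSpecification (d := 4) (fundamentalRep (Fin 2)) t Λ η)) =
        2 * ∫ U, zdPlaquetteObs (d := 4) (fundamentalRep (Fin 2)) x i j U
          ∂(ymSpecification (d := 4) (fundamentalRep (Fin 2)) t Λ η) := by
      rw [← integral_const_mul]; exact integral_congr_ae (ae_of_all _ hWeq)
    have hI2 : (∫ U, W U ∂μ) = 2 * ∫ U, zdPlaquetteObs (d := 4) (fundamentalRep (Fin 2)) x i j U ∂μ := by
      rw [← integral_const_mul]; exact integral_congr_ae (ae_of_all _ hWeq)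
    have hE : 0 ≤ Real.exp (-(starRate 4 (gaugeR (2 * t)) * ⌊m / (4 : ℕ)⌋₊)) := (Real.exp_pos _).le
    rw [hI1, hI2, ← mul_sub, abs_mul, abs_two]
    calc 2 * |(∫ U, zdPlaquetteObs (d := 4) (fundamentalRep (Fin 2)) x i j U
              ∂(ymSpecification (d := 4) (fundamentalRep (Fin 2)) t Λ η)) -
            ∫ U, zdPlaquetteObs (d := 4) (fundamentalRep (Fin 2)) x i j U ∂μ|
        ≤ 2 * (4 * Real.sqrt 2 * ((4 * (2 : ℝ≥0) ^ 3 : ℝ≥0) : ℝ) * (plaquetteEdges ((x, ⟨(i, j), hij⟩) : ZdPlaquette 4)).card *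
            Real.exp (-(starRate 4 (gaugeR (2 * t)) * ⌊m / (4 : ℕ)⌋₊))) := mul_le_mul_of_nonneg_left key (by norm_num)
      _ ≤ 2 * (4 * Real.sqrt 2 * ((4 * (2 : ℝ≥0) ^ 3 : ℝ≥0) : ℝ) * 4 *
            Real.exp (-(starRate 4 (gaugeR (2 * b)) * ⌊m / (4 : ℕ)⌋₊))) := by
          gcongr
      _ = 1024 * Real.sqrt 2 * Real.exp (-(starRate 4 (gaugeR (2 * b)) * ⌊m / (4 : ℕ)⌋₊)) := by push_cast; ring
  · -- a link of `p` lies outside `Λ`: `m ≤ 0`, the bound is `≥ 1024√2 ≥ 4`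
    obtain ⟨x, hx, hxΛ⟩ := Finset.not_subset.1 hp
    have hφx : φ x ≤ 0 := by
      by_contra h
      exact hxΛ (hφΛ x (lt_of_not_ge h))
    have hm0 : m / (4 : ℕ) ≤ 0 := by
      have := (hm x hx).trans hφx
      have h4 : (0 : ℝ) < (4 : ℕ) := by norm_num
      exact div_nonpos_of_nonpos_of_nonneg (by linarith) h4.le
    rw [Nat.floor_of_nonpos hm0, Nat.cast_zero, mul_zero, neg_zero, Real.exp_zero, mul_one]
    have hs : (1 : ℝ) ≤ Real.sqrt 2 := Real.one_le_sqrt.2 (by norm_num)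
    linarith

/-- `f(0) = 0`: at zero coupling the torus partition functions are `1` (a corollary of rb-p2's two-sided free-energy law). [folklore] -/
theorem su2_freeEnergyDensity_zero : freeEnergyDensity 4 (fundamentalRep (Fin 2)) 0 = 0 := by
  have h := FreeEnergyLaw.freeEnergyDensity_two_sided (d := 4) (fundamentalRep (Fin 2))
    (Literature.MathematicalPhysics.QuantumFieldTheory.TorusAreaLaw.isSpecialUnitaryModel_fundamentalRep 2) le_rfl (by norm_num) (le_refl (0 : ℝ))
  simp only [mul_zero, zero_pow two_ne_zero, zero_div, add_zero, neg_zero, Real.exp_zero, mul_one] at h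
  exact le_antisymm h.2 h.1

/-- The kernel energy is the sum of the plaquette terms: `∫ S_Λ dγ_Λ^s(·|η) = Σ_{p ∈ T(Λ)} (2 − ∫ Re tr U_p dγ_Λ^s(·|η))`. [folklore] -/
theorem su2_integral_wilsonBoundaryAction_kernel (s : ℝ) (Λ : Finset (ZdEdge 4)) (η : LGConfig 4 (SUN 2)) :
    ∫ U, wilsonBoundaryAction (fundamentalRep (Fin 2)) Λ U ∂(ymSpecification (d := 4) (fundamentalRep (Fin 2)) s Λ η) =
      ∑ p ∈ plaquettesTouching Λ, ((2 : ℝ) - ∫ U, plaquetteObs (fundamentalRep (Fin 2)) p.1 p.2.1.1 p.2.1.2 U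
        ∂(ymSpecification (d := 4) (fundamentalRep (Fin 2)) s Λ η)) := by
  have hρc : Continuous (fundamentalRep (Fin 2)) := continuous_fundamentalRep (Fin 2)
  haveI := isProbabilityMeasure_ymSpecification (fundamentalRep (Fin 2)) hρc s Λ η
  have hWi : ∀ p : ZdPlaquette 4, Integrable (fun U : LGConfig 4 (SUN 2) =>
      plaquetteObs (fundamentalRep (Fin 2)) p.1 p.2.1.1 p.2.1.2 U)
      (ymSpecification (d := 4) (fundamentalRep (Fin 2)) s Λ η) :=
    fun p => integrable_of_bound (continuous_plaquetteObs (fundamentalRep (Fin 2)) hρc _ _ _).measurable.aestronglyMeasurable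
      (C := 2) fun U => by
        simpa using abs_plaquetteObs_le_holds (fundamentalRep (Fin 2)) fundamentalRep_mem_unitaryGroup p.1 p.2.1.1 p.2.1.2 U
  have hI : ∀ p ∈ plaquettesTouching Λ, Integrable (fun U : LGConfig 4 (SUN 2) =>
      ((2 : ℕ) : ℝ) - plaquetteObs (fundamentalRep (Fin 2)) p.1 p.2.1.1 p.2.1.2 U)
      (ymSpecification (d := 4) (fundamentalRep (Fin 2)) s Λ η) :=
    fun p _ => (integrable_const _).sub (hWi p)
  unfold wilsonBoundaryAction
  rw [integral_finsetSum _ hI]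
  refine Finset.sum_congr rfl fun p _ => ?_
  rw [integral_sub (integrable_const _) (hWi p), integral_const, smul_eq_mul, Measure.real, measure_univ, ENNReal.toReal_one,
    one_mul]
  norm_num

/-- ★★★ **«C-DS-I»: THE FREE ENERGY OF A FINITE REGION WITH AN ARBITRARY BOUNDARY FIELD IS THE VOLUME TERM PLUS A BOUNDARY-UNIFORM
SURFACE TERM** (`SU(2)`, `d = 4`, Wilson action, tree coupling `0 ≤ b ≤ 9/50`, i.e. EVERY `0 ≤ β_W ≤ 9/25`). For every finite link volume
`Λ`, EVERY boundary field `η`, every depth function `φ` of `Λ` (`φ x ≤ φ y + ‖x.1 − y.1‖_∞`, `φ x > 0 ⇒ x ∈ Λ`) and depths `m_p ≤ φ` on the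
links of the plaquettes `p ∈ T(Λ)` touching `Λ`:
`|log Z_Λ(b|η) − (#T(Λ)/6)·f(b)| ≤ b · Σ_{p∈T(Λ)} min 4 (1024√2 · exp(−κ₁(R_G(2b)) ⌊m_p/4⌋))`,
`Z_Λ(b|η) = ∫ exp(−b S_Λ(ζ ⊕ η_{Λᶜ})) ∏_{e∈Λ} dζ_e` the normaliser of the DLR kernel `γ_Λ(·|η)`, `f = freeEnergyDensity 4 ρ` the infinite-volume
free energy per site (`6` plaquettes per site), `κ₁ = starRate 4`, `R_G = gaugeR`: the error is summable in the depth — a surface term — with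
ONE constant for all volumes and all boundary fields (Dobrushin–Shlosman's Condition I shape). [folklore] -/
theorem su2_abs_log_normaliser_sub_freeEnergy_le {b : ℝ} (hb0 : 0 ≤ b) (hb : b ≤ 9 / 50)
    (Λ : Finset (ZdEdge 4)) (η : LGConfig 4 (SUN 2)) (φ : ZdEdge 4 → ℝ)
    (hφ : ∀ x y : ZdEdge 4, φ x ≤ φ y + ‖x.1 - y.1‖) (hφΛ : ∀ x, 0 < φ x → x ∈ Λ)
    (m : ZdPlaquette 4 → ℝ) (hm : ∀ p ∈ plaquettesTouching Λ, ∀ x ∈ plaquetteEdges p, m p ≤ φ x) :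
    |Real.log (∫ ζ, Real.exp (-b * wilsonBoundaryAction (fundamentalRep (Fin 2)) Λ (glueWith Λ ζ η))
          ∂(Measure.pi fun _ : ↥Λ => haarProbability (SUN 2))) -
        (plaquettesTouching Λ).card / 6 * freeEnergyDensity 4 (fundamentalRep (Fin 2)) b| ≤
      b * ∑ p ∈ plaquettesTouching Λ,
        min 4 (1024 * Real.sqrt 2 * Real.exp (-(starRate 4 (gaugeR (2 * b)) * ⌊m p / (4 : ℕ)⌋₊))) := by
  have hρc : Continuous (fundamentalRep (Fin 2)) := continuous_fundamentalRep (Fin 2)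
  set T := plaquettesTouching Λ with hT
  set E : ℝ := ∑ p ∈ T, min 4 (1024 * Real.sqrt 2 * Real.exp (-(starRate 4 (gaugeR (2 * b)) * ⌊m p / (4 : ℕ)⌋₊))) with hE
  set LZ : ℝ → ℝ := fun s => Real.log (∫ ζ, Real.exp (-s * wilsonBoundaryAction (fundamentalRep (Fin 2)) Λ (glueWith Λ ζ η))
      ∂(Measure.pi fun _ : ↥Λ => haarProbability (SUN 2))) with hLZ
  set f : ℝ → ℝ := freeEnergyDensity 4 (fundamentalRep (Fin 2)) with hf
  set D : ℝ → ℝ := fun s => LZ s - (T.card : ℝ) / 6 * f s with hD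
  -- the one state of the window at each coupling (junk off the window)
  have hex : ∀ s : ℝ, ∃ ν : Measure (LGConfig 4 (SUN 2)), s ∈ Icc (0 : ℝ) (9 / 50) →
      ymGibbsMeasures (d := 4) (fundamentalRep (Fin 2)) s = {ν} ∧
        infiniteVolumeLimitPoints (d := 4) (fundamentalRep (Fin 2)) s = {ν} := by
    intro s
    by_cases hs : s ∈ Icc (0 : ℝ) (9 / 50)
    · have habs : |s| ≤ 9 / 50 := abs_le.2 ⟨by linarith [hs.1], hs.2⟩
      obtain ⟨ν, h1, h2, -, -⟩ := su2_wilson_oneState_symmetric habs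
      exact ⟨ν, fun _ => ⟨h1, h2⟩⟩
    · exact ⟨0, fun h => absurd h hs⟩
  choose ν hν using hex
  have hνG : ∀ s ∈ Icc (0 : ℝ) (9 / 50), ν s ∈ ymGibbsMeasures (d := 4) (fundamentalRep (Fin 2)) s := fun s hs => by
    rw [(hν s hs).1]; exact Set.mem_singleton _
  have hνL : ∀ s ∈ Icc (0 : ℝ) (9 / 50), ν s ∈ infiniteVolumeLimitPoints (d := 4) (fundamentalRep (Fin 2)) s := fun s hs => by
    rw [(hν s hs).2]; exact Set.mem_singleton _
  -- axis symmetry: all plaquette expectations of the one state agree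
  have hplane : ∀ s ∈ Icc (0 : ℝ) (9 / 50), ∀ (y : Site 4) (i j : Fin 4), i ≠ j →
      ∫ U, plaquetteObs (fundamentalRep (Fin 2)) y i j U ∂(ν s) = ∫ U, plaquetteObs (fundamentalRep (Fin 2)) 0 0 1 U ∂(ν s) :=
    fun s hs y i j hij => PlaquettePositivity.integral_plaquetteObs_eq (fundamentalRep (Fin 2)) hρc (by norm_num) (hνL s hs) y hij
  -- the derivative of `D` inside the window is the sum of the boundary errors of the plaquettes touching `Λ`
  have hDer : ∀ s ∈ Icc (0 : ℝ) (9 / 50), HasDerivWithinAt D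
      (∑ p ∈ T, ((∫ U, plaquetteObs (fundamentalRep (Fin 2)) p.1 p.2.1.1 p.2.1.2 U
          ∂(ymSpecification (d := 4) (fundamentalRep (Fin 2)) s Λ η)) -
        ∫ U, plaquetteObs (fundamentalRep (Fin 2)) p.1 p.2.1.1 p.2.1.2 U ∂(ν s))) (Icc (0 : ℝ) (9 / 50)) s := by
    intro s hs
    have h1 : HasDerivWithinAt LZ (-(∫ U, wilsonBoundaryAction (fundamentalRep (Fin 2)) Λ U
        ∂(ymSpecification (d := 4) (fundamentalRep (Fin 2)) s Λ η))) (Icc (0 : ℝ) (9 / 50)) s :=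
      (hasDerivAt_log_normaliser (fundamentalRep (Fin 2)) hρc Λ η s).hasDerivWithinAt
    have h2 := PressureRegularity.su2_hasDerivWithinAt_freeEnergyDensity hνG hs
    have h3 := h1.fun_sub (h2.const_mul ((T.card : ℝ) / 6))
    refine h3.congr_deriv ?_
    rw [su2_integral_wilsonBoundaryAction_kernel]
    have hq : ∑ q : {q : Fin 4 × Fin 4 // q.1 < q.2},
        ((2 : ℝ) - ∫ U, plaquetteObs (fundamentalRep (Fin 2)) 0 q.1.1 q.1.2 U ∂(ν s)) =
        6 * (2 - ∫ U, plaquetteObs (fundamentalRep (Fin 2)) 0 0 1 U ∂(ν s)) := by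
      rw [Finset.sum_congr rfl fun q _ => by rw [hplane s hs 0 q.1.1 q.1.2 (ne_of_lt q.2)], Finset.sum_const, Finset.card_univ,
        show Fintype.card {q : Fin 4 × Fin 4 // q.1 < q.2} = 6 from by decide, nsmul_eq_mul]
      norm_num
    have hp : ∀ p ∈ T, ∫ U, plaquetteObs (fundamentalRep (Fin 2)) p.1 p.2.1.1 p.2.1.2 U ∂(ν s) =
        ∫ U, plaquetteObs (fundamentalRep (Fin 2)) 0 0 1 U ∂(ν s) := fun p _ => hplane s hs p.1 _ _ (ne_of_lt p.2.2)
    rw [hq, Finset.sum_sub_distrib, Finset.sum_sub_distrib, Finset.sum_congr rfl hp, Finset.sum_const, Finset.sum_const,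
      nsmul_eq_mul, nsmul_eq_mul]
    ring
  -- the derivative is bounded by `E` on `[0, b]`
  have hD' : ∀ s ∈ Icc (0 : ℝ) b,
      ‖∑ p ∈ T, ((∫ U, plaquetteObs (fundamentalRep (Fin 2)) p.1 p.2.1.1 p.2.1.2 U
          ∂(ymSpecification (d := 4) (fundamentalRep (Fin 2)) s Λ η)) -
        ∫ U, plaquetteObs (fundamentalRep (Fin 2)) p.1 p.2.1.1 p.2.1.2 U ∂(ν s))‖ ≤ E := by
    intro s hs
    rw [Real.norm_eq_abs]
    refine (Finset.abs_sum_le_sum_abs _ _).trans (Finset.sum_le_sum fun p hp => ?_)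
    exact su2_abs_kernel_plaquette_sub_le hs.1 hs.2 hb (hνG s ⟨hs.1, hs.2.trans hb⟩) Λ η φ hφ hφΛ p (hm p hp)
  -- the mean value inequality on `[0, b]`
  have hMVT := Convex.norm_image_sub_le_of_norm_hasDerivWithin_le (f := D) (s := Icc (0 : ℝ) b)
    (fun s hs => (hDer s ⟨hs.1, hs.2.trans hb⟩).mono (Icc_subset_Icc_right hb)) hD' (convex_Icc 0 b)
    (left_mem_Icc.2 hb0) (right_mem_Icc.2 hb0)
  have hLZ0 : LZ 0 = 0 := log_normaliser_zero (fundamentalRep (Fin 2)) Λ η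
  have hf0 : f 0 = 0 := su2_freeEnergyDensity_zero
  have hD0 : D 0 = 0 := by
    show LZ 0 - (T.card : ℝ) / 6 * f 0 = 0
    rw [hLZ0, hf0]; ring
  rw [hD0, sub_zero, sub_zero, Real.norm_eq_abs, Real.norm_eq_abs, abs_of_nonneg hb0] at hMVT
  calc |D b| ≤ E * b := hMVT
    _ = b * E := mul_comm _ _

/-- ★★ **TWO BOUNDARY FIELDS CHANGE THE FREE ENERGY OF A FINITE REGION BY A SURFACE TERM ONLY**, uniformly in the pair of boundary fields
(`SU(2)`, `d = 4`, EVERY `0 ≤ β_W ≤ 9/25`; same depth data as above):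
`|log Z_Λ(b|η) − log Z_Λ(b|ω)| ≤ 2b · Σ_{p∈T(Λ)} min 4 (1024√2 · exp(−κ₁(R_G(2b)) ⌊m_p/4⌋))`. [folklore] -/
theorem su2_abs_log_normaliser_sub_log_normaliser_le {b : ℝ} (hb0 : 0 ≤ b) (hb : b ≤ 9 / 50)
    (Λ : Finset (ZdEdge 4)) (η ω : LGConfig 4 (SUN 2)) (φ : ZdEdge 4 → ℝ)
    (hφ : ∀ x y : ZdEdge 4, φ x ≤ φ y + ‖x.1 - y.1‖) (hφΛ : ∀ x, 0 < φ x → x ∈ Λ)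
    (m : ZdPlaquette 4 → ℝ) (hm : ∀ p ∈ plaquettesTouching Λ, ∀ x ∈ plaquetteEdges p, m p ≤ φ x) :
    |Real.log (∫ ζ, Real.exp (-b * wilsonBoundaryAction (fundamentalRep (Fin 2)) Λ (glueWith Λ ζ η))
          ∂(Measure.pi fun _ : ↥Λ => haarProbability (SUN 2))) -
        Real.log (∫ ζ, Real.exp (-b * wilsonBoundaryAction (fundamentalRep (Fin 2)) Λ (glueWith Λ ζ ω))
          ∂(Measure.pi fun _ : ↥Λ => haarProbability (SUN 2)))| ≤
      2 * b * ∑ p ∈ plaquettesTouching Λ,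
        min 4 (1024 * Real.sqrt 2 * Real.exp (-(starRate 4 (gaugeR (2 * b)) * ⌊m p / (4 : ℕ)⌋₊))) := by
  have h1 := su2_abs_log_normaliser_sub_freeEnergy_le hb0 hb Λ η φ hφ hφΛ m hm
  have h2 := su2_abs_log_normaliser_sub_freeEnergy_le hb0 hb Λ ω φ hφ hφΛ m hm
  rw [abs_le] at h1 h2 ⊢
  constructor <;> linarith [h1.1, h1.2, h2.1, h2.2]

end SU2

end BoundaryFreeEnergy

end Summit.Ventures.YMGap.RobustBall

end
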